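import Summits.QuantumFields.BalabanUV.T4Continuum.Support.InsertionChannelFamilyComplexEntrywise
import Summits.QuantumFields.BalabanUV.T4Continuum.Support.SubstrateFineFieldChart
import Summits.QuantumFields.BalabanUV.T4Continuum.Support.SubstrateO1ReadingsShiftRate

/-!
# B13EntrywiseRateFineField — row E-avg: THE ROAD-D W1 CHAIN AT THE SUBSTRATE INSTANCE ON THE FINE-FIELD ROAD — the owner's g38-a §4
# `OutputRateDrivingSlices.weightedEntrywiseRate_complex_of_drivingSlices` READ AT the substrate's W-22′ `SubstrateFineFieldChart` (`hdrv` DISCHARGED BY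
# NAME), the chart ∕ section of record, and the W1 face OF RECORD `WeightedEntrywiseRate S.F (assembly S).rawAt S.rawB W δ (k ↦ θ^k)` (W-21c BY NAME at
# the cov-shifted slots); then the channel road's END (part 8) on top (cell `pub-balaban`, row NE5, node U3; NE5 owner R57∕R58 `HOME/CLAIMS.log`
# l.22107∕l.22206 «E-drv ↦ E-avg, first refusal leaf-06 ∕ leaf-02»; substrate typer (ο7-1) l.22257; leaf-02 deferral l.22497∕l.22735; INTENT this unit gen 19)

Unit `b2b-balaban-t4-ne5-formalise-leaf-06` (NE5 formalisation swarm, leaf prover 06, gen 19).  Summits-side NEW WORK under the LEAN PLACEMENT RULE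
(cell bookkeeping: the owner's generic socket APPLIED BY NAME at the substrate's objects; nothing of the manuscripts under audit is asserted; 0 cite
tags; 0 `def`; no `Prop`-valued fact minted).  HONEST FRAMING: rung (B)+1 of the FINITE-VOLUME T⁴ continuum programme — NOT infinite volume, NOT a
mass gap, NOT the Clay problem, NOT a proof of NE5 (`T4OutputRate.NE5`, NOT PRINTED; cell GAPS G-t4-U3-1) nor of NE2 ∕ NE3 ∕ NE9; spine 0/9 unchanged;
0/12 leaves instantiated on Bałaban's concrete objects (O1 = the substrate cell, owner R34).  HONEST DEPENDENCY (cell line, verbatim): continuum YM on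
T⁴ ⇐ BetaPertH ∧ nine spine estimates (0/9 proved); BetaPertH ⇐ (D1) ∧ (D4) ∧ CAP+tail; G-an2-4 gates asym, D1 and NE2/3/4.

WHY.  After RULING R58 the W1 binder of Road D over the COMPLEX recursion chart comes from (i) the W1 face OF RECORD on the REAL run-B carrier (rows
NE2's two-level tower rates + the O1 reading letters: the owner's `B13ReadingsRecord*` faces, instantiated by the substrate's W-21b ∕ W-21c — each
concluding LITERALLY `WeightedEntrywiseRate S.F (assembly S).rawAt S.rawB W c rate` for its slots `S`), (ii) the complex interpolation along FINE-FIELD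
SLICES — W-22′ `FineFieldChart D ι Wreg 𝒰 emb ϱ r`, whose END `FineFieldChart.hdrv` ∕ `hdrv_on` IS g38-a's `hdrv` letter token for token at `Coord :=
TowerData (D.F.P (D.K+1)) o`, `𝒱 := TwoRunChart D o`, `χ := chartAt D ι`, `ρ := sectionOfRecord D ι` (resp. `rho D ι Wreg`) —, and (iii) per-species
letters, DISPLAYED here: COMPLEX KERNELS `FA` ∕ `FB` of the two runs' species on their OWN tower charts whose values at the two factors of the section
of record ARE the record's raw species (`hAr : (assembly S).rawAt g b k = FA g k (sectionOfRecord D ι b).1`, `hBr : S.rawB g b k = FB g k (towerB D ι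
b)` — [dict] D-8 (i)-type identities, cf. `covAtOfRecord_eq_covAtT` ∕ W-20 `covAtOfRecord_transport` for the covariance species) obeying (L1) in the
substrate's explicit-ball shapes (W-22′ `hKA_of_resA` ∕ `hKB_of_chart` carry them to `chartAt D ι` — substrate-p2's junction (J4)).  The reading
points `𝒰`, `emb` are the row's PARAMETERS (typer (ο7-1)(α′)); the raw families over the chart are READ OFF the kernels (`hA`∕`hB` by `rfl`).

WHAT ([folklore] composition BY NAME; NO estimate; 0 def).
* §1 `weightedEntrywiseRate_chart_of_fineFieldChart` (whole carrier) ∕ `…_on` (window `Wreg`): g38-a §4 with `hdrv` DISCHARGED by W-22′ and (L1) fed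
  from the runs' OWN chart letters by `hKA_of_resA` ∕ `hKB_of_chart` — generic entry type `E`, formats `Fk`, raw families on `D.carriers.BgB` (resp.
  `↥Wreg`); output `WeightedEntrywiseRate Fk (g u k ↦ FA g k (emb u).1) (g u k ↦ FB g k (emb u).2) W (δ^{1−λ}(2B)^{λ}) (k ↦ (θ^{1−λ})^k) ∧ RawBounded ×2`.
* §2 **`weightedEntrywiseRate_chart_of_record`** — §1 AT THE RECORD's W1 CURRENCY: for any slots `S : B13StepOfRecord.Slots D.toTwoRuns E IOp Hst`
  the W1 face of record `hwer : WeightedEntrywiseRate S.F (assembly S).rawAt S.rawB W δ (k ↦ θ^k)` (DISPLAYED in exactly the shape W-21b ∕ W-21c ∕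
  `B13ReadingsRecordRate.weightedEntrywiseRate_record_balaban_rate_on` conclude, so each feeds it by `exact` at its `S`, with `θ := √(max θ L⁻¹)`),
  the kernel identifications `hAr`∕`hBr`, (L1) own-chart, and a fine-field chart over the whole carrier ⟹ W1 over the recursion chart for the
  formats OF RECORD `S.F` (window form = §1's `_on`, one line).
* §3 **`ne5_channel_of_record_fineFieldChart`** — part 8 §2 on top of §2: per-point slots `P` on Road D's doubled complex chart over `D.carriers`
  reading `opOf S.F (k-th kernels at emb u)` row-blind + part 5's channel-road letters ⟹ LITERALLY `T4OutputRate.NE5 EA EB W κ θ₁ C₅`, `θ₁ = θ^{1−λ(r)}`.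
* §4 **`weightedEntrywiseRate_chart_of_slotsOfRecordShift_rate`** — §2 AT `S := slotsOfRecordShift D ιr …` (W-21) with `hwer` DISCHARGED by the
  substrate's W-21c `SubstrateO1ReadingsShiftRate.weightedEntrywiseRate_slotsOfRecordShift_balaban_rate` BY NAME (its binders displayed verbatim).
NOT IN THIS FILE (said plainly).  No complex kernel `FA`∕`FB` is CONSTRUCTED (the complexified raw species of record and their restriction
identities are the substrate's L-E18 ∕ D-8 (i) layer — DISPLAYED); (L1) is DISPLAYED (landed for the covariance ∕ Green species on the explicit ball —
W-20b, W-15, p223952 — not threaded here); behind the W1 face: rows NE2's rates + O1 letters, asserted by nobody; the per-point slots `P` of §3 and their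
readings are DISPLAYED (no Road-D slot instance on Bałaban's objects exists); W-22′'s letters (2′)(3)(4) are displayed structure fields, inhabited
trivially only.  Headline (trigger c5 ∕ referee INFO-38): «E-avg — END ⇐ instance letters; `hdrv` + W1-face sockets closed BY NAME»; never «leaf
instantiated» ∕ «NE5 proved».  NE5 NOT PROVED; spine 0/9; 0/12; rung (B)+1 finite T⁴; NOT infinite volume ∕ mass gap ∕ Clay.  Axioms ⊆ the trio.
-/

noncomputable section

open scoped BigOperators ComplexConjugate Matrix Matrix.Norms.L2Operator Kronecker ComplexOrder
open Finset Function Metric Set Complex Real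

namespace Summit.QuantumFields.BalabanUV.T4Continuum.B13EntrywiseRateFineField

open Literature.MathematicalPhysics.QuantumFieldTheory.Balaban1983to89
open Literature.MathematicalPhysics.QuantumFieldTheory.Balaban1983to89.T4OutputRate (Carriers Functional NE5)
open Literature.MathematicalPhysics.QuantumFieldTheory.Balaban1983to89.T4InputCauchyRateData (StepModel tableA tableB)
open Literature.MathematicalPhysics.QuantumFieldTheory.Balaban1983to89.T4HistoryLipschitzRecursion
  (ChannelAdditive ChannelStepSum ChannelSizeAtStepNN)
open Summit.QuantumFields.BalabanUV.T4Continuum.B13HistDatum (HistFrame Hist)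
open Summit.QuantumFields.BalabanUV.T4Continuum.B13OpDatum (Format OpDatum)
open Summit.QuantumFields.BalabanUV.T4Continuum.B13OpDatumJunctions (opOf RawBounded WeightedEntrywiseRate)
open Summit.QuantumFields.BalabanUV.T4Continuum.B13StepOfRecord (Slots assembly)
open Summit.QuantumFields.BalabanUV.T4Continuum.OutputRateFunctionalTablesPointwise (PointwiseSlots)
open Summit.QuantumFields.BalabanUV.T4Continuum.OutputRateFunctionalTablesComplex (reImTab)
open Summit.QuantumFields.BalabanUV.T4Continuum.OutputRateDrivingSlices (weightedEntrywiseRate_complex_of_drivingSlices)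
open Summit.QuantumFields.BalabanUV.T4Continuum.InsertionChannelFamily
  (insAtOfChannelC ne5_of_pointwiseSlots_reIm_insAtC_of_weightedEntrywiseRate)
open Summit.QuantumFields.BalabanUV.T4Continuum.OutputRateComplexSliceEnd (degradedAmp_nonneg)
open Summit.QuantumFields.BalabanUV.T4Continuum.SubstrateTransporterSpecies (TowerData)
open Summit.QuantumFields.BalabanUV.T4Continuum.SubstrateChartSection (sectionOfRecord TwoRunChart)
open Summit.QuantumFields.BalabanUV.T4Continuum.SubstrateTwoRunsDriven (DrivenRuns)
open Summit.QuantumFields.BalabanUV.T4Continuum.SubstrateTransporterSpeciesHolo (expChartT)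
open Summit.QuantumFields.BalabanUV.T4Continuum.SubstrateFineFieldChart (towerB chartAt rho FineFieldChart hKA_of_resA hKB_of_chart)

variable {G : Type} [GaugeGroup G] (D : DrivenRuns G) {o : Type} [Fintype o] [DecidableEq o] (ι : G →* Matrix o o ℂ)
variable {E : Type*} {𝒰 : Type}

/-! ## §1 g38-a §4 READ AT W-22′'s fine-field chart: `hdrv` discharged BY NAME; (L1) in the two runs' OWN chart letters -/

/-- [folklore] **W1 OVER THE RECURSION CHART FROM THE REAL CARRIER + THE RUNS' OWN CHART LETTERS + A FINE-FIELD CHART (whole carrier).**  The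
owner's g38-a §4 `weightedEntrywiseRate_complex_of_drivingSlices` at `Coord := TowerData (D.F.P (D.K+1)) o`, `𝒱 := TwoRunChart D o`, `Ctr = BgR :=
D.carriers.BgB`, `χ := chartAt D ι`, `ρ := sectionOfRecord D ι`, kernels reading each run's OWN factor of the chart point (`KA g k v := FA g k v.1`,
`KB g k v := FB g k v.2`), with `hdrv` DISCHARGED by W-22′'s `FineFieldChart.hdrv` and (L1) fed from the runs' OWN chart letters through W-22′'s
`hKA_of_resA` (run A: chain rule through the contraction `resA`) ∕ `hKB_of_chart` (run B) — substrate-p2's junction (J4).  Displayed: the real-carrier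
W1 binder `hwer` on `rawAr rawBr` over `D.carriers.BgB` at rate `θ^k`, the kernel readings `hAr`∕`hBr` at the two factors of the section of record, and
(L1) in the substrate's explicit-ball shapes (format bound `B·wt e` on `‖c‖ < ϱ k b`).  Output: W1 over the recursion chart `𝒰` at the owner's
degraded pair + `RawBounded` ×2. -/
theorem weightedEntrywiseRate_chart_of_fineFieldChart {emb : 𝒰 → TwoRunChart D o} {ϱ : ℕ → D.carriers.BgB → ℝ} {r : ℝ}
    (𝒞 : FineFieldChart D ι (Set.univ : Set D.carriers.BgB) 𝒰 emb ϱ r) (Fk : ℕ → Format E)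
    {rawAr rawBr : (ℕ → ℝ) → D.carriers.BgB → ℕ → E → ℂ}
    {FA : (ℕ → ℝ) → ℕ → TowerData (D.F.P D.K) o → E → ℂ} {FB : (ℕ → ℝ) → ℕ → TowerData (D.F.P (D.K + 1)) o → E → ℂ}
    {W : Set (ℕ → ℝ)} {δ θ B : ℝ} (hδ : 0 ≤ δ) (hδB : δ ≤ 2 * B) (hθ : 0 ≤ θ) (hθ1 : θ ≤ 1) (hr : r < 1)
    (hAr : ∀ g ∈ W, ∀ b k, rawAr g b k = FA g k (sectionOfRecord D ι b).1) (hBr : ∀ g ∈ W, ∀ b k, rawBr g b k = FB g k (towerB D ι b))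
    (hwer : WeightedEntrywiseRate Fk rawAr rawBr W δ fun k => θ ^ k)
    (hFA : ∀ k, ∀ g ∈ W, ∀ (b : D.carriers.BgB) (e : E),
      DifferentiableOn ℂ (fun cA => FA g k (expChartT _ (sectionOfRecord D ι b).1 cA) e) (ball 0 (ϱ k b)) ∧
      ∀ cA ∈ ball (0 : TowerData (D.F.P D.K) o) (ϱ k b), ‖FA g k (expChartT _ (sectionOfRecord D ι b).1 cA) e‖ ≤ B * (Fk k).wt e)
    (hFB : ∀ k, ∀ g ∈ W, ∀ (b : D.carriers.BgB) (e : E),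
      DifferentiableOn ℂ (fun c => FB g k (expChartT _ (towerB D ι b) c) e) (ball 0 (ϱ k b)) ∧
      ∀ c ∈ ball (0 : TowerData (D.F.P (D.K + 1)) o) (ϱ k b), ‖FB g k (expChartT _ (towerB D ι b) c) e‖ ≤ B * (Fk k).wt e) :
    WeightedEntrywiseRate Fk (fun g u k => FA g k (emb u).1) (fun g u k => FB g k (emb u).2) W
      (δ ^ (1 - (2 / π * Real.arctan (2 * r / (1 - r ^ 2)))) * (2 * B) ^ (2 / π * Real.arctan (2 * r / (1 - r ^ 2)))) (fun k => (θ ^ (1 - (2 / π * Real.arctan (2 * r / (1 - r ^ 2))))) ^ k) ∧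
      RawBounded Fk (fun g u k => FA g k (emb u).1) W ∧ RawBounded Fk (fun g u k => FB g k (emb u).2) W :=
  weightedEntrywiseRate_complex_of_drivingSlices Fk (sectionOfRecord D ι) emb (chartAt D ι) (KA := fun g k v => FA g k v.1)
    (KB := fun g k v => FB g k v.2) hδ hδB hθ hθ1 hr hAr hBr (fun _ _ _ _ => rfl) (fun _ _ _ _ => rfl) hwer
    (fun k g hg b e => hKA_of_resA D ι (FA := fun x => FA g k x e) (hFA k g hg b e).1 (hFA k g hg b e).2)
    (fun k g hg b e => hKB_of_chart D ι (FB := fun x => FB g k x e) (hFB k g hg b e).1 (hFB k g hg b e).2) 𝒞.hdrv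

/-- [folklore] **The same over a WINDOW `Wreg ⊆ D.carriers.BgB` of real admissible run-B fields**: `Ctr = BgR := ↥Wreg`, `ρ := rho D ι Wreg`,
`χ b := chartAt D ι b.1`, radii `ϱ k b.1`, `hdrv` DISCHARGED by `FineFieldChart.hdrv_on`; W1, the readings and (L1) are asked on the window only. -/
theorem weightedEntrywiseRate_chart_of_fineFieldChart_on {Wreg : Set D.carriers.BgB} {emb : 𝒰 → TwoRunChart D o}
    {ϱ : ℕ → D.carriers.BgB → ℝ} {r : ℝ} (𝒞 : FineFieldChart D ι Wreg 𝒰 emb ϱ r) (Fk : ℕ → Format E)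
    {rawAr rawBr : (ℕ → ℝ) → Wreg → ℕ → E → ℂ}
    {FA : (ℕ → ℝ) → ℕ → TowerData (D.F.P D.K) o → E → ℂ} {FB : (ℕ → ℝ) → ℕ → TowerData (D.F.P (D.K + 1)) o → E → ℂ}
    {W : Set (ℕ → ℝ)} {δ θ B : ℝ} (hδ : 0 ≤ δ) (hδB : δ ≤ 2 * B) (hθ : 0 ≤ θ) (hθ1 : θ ≤ 1) (hr : r < 1)
    (hAr : ∀ g ∈ W, ∀ (b : Wreg) (k : ℕ), rawAr g b k = FA g k (sectionOfRecord D ι b.1).1)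
    (hBr : ∀ g ∈ W, ∀ (b : Wreg) (k : ℕ), rawBr g b k = FB g k (towerB D ι b.1))
    (hwer : WeightedEntrywiseRate Fk rawAr rawBr W δ fun k => θ ^ k)
    (hFA : ∀ k, ∀ g ∈ W, ∀ (b : Wreg) (e : E),
      DifferentiableOn ℂ (fun cA => FA g k (expChartT _ (sectionOfRecord D ι b.1).1 cA) e) (ball 0 (ϱ k b.1)) ∧
      ∀ cA ∈ ball (0 : TowerData (D.F.P D.K) o) (ϱ k b.1), ‖FA g k (expChartT _ (sectionOfRecord D ι b.1).1 cA) e‖ ≤ B * (Fk k).wt e)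
    (hFB : ∀ k, ∀ g ∈ W, ∀ (b : Wreg) (e : E),
      DifferentiableOn ℂ (fun c => FB g k (expChartT _ (towerB D ι b.1) c) e) (ball 0 (ϱ k b.1)) ∧
      ∀ c ∈ ball (0 : TowerData (D.F.P (D.K + 1)) o) (ϱ k b.1), ‖FB g k (expChartT _ (towerB D ι b.1) c) e‖ ≤ B * (Fk k).wt e) :
    WeightedEntrywiseRate Fk (fun g u k => FA g k (emb u).1) (fun g u k => FB g k (emb u).2) W
      (δ ^ (1 - (2 / π * Real.arctan (2 * r / (1 - r ^ 2)))) * (2 * B) ^ (2 / π * Real.arctan (2 * r / (1 - r ^ 2)))) (fun k => (θ ^ (1 - (2 / π * Real.arctan (2 * r / (1 - r ^ 2))))) ^ k) ∧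
      RawBounded Fk (fun g u k => FA g k (emb u).1) W ∧ RawBounded Fk (fun g u k => FB g k (emb u).2) W :=
  weightedEntrywiseRate_complex_of_drivingSlices Fk (rho D ι Wreg) emb (fun b : Wreg => chartAt D ι b.1) (ϱ := fun k (b : Wreg) => ϱ k b.1)
    (KA := fun g k v => FA g k v.1) (KB := fun g k v => FB g k v.2) hδ hδB hθ hθ1 hr hAr hBr (fun _ _ _ _ => rfl) (fun _ _ _ _ => rfl) hwer
    (fun k g hg b e => hKA_of_resA D ι (FA := fun x => FA g k x e) (hFA k g hg b e).1 (hFA k g hg b e).2)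
    (fun k g hg b e => hKB_of_chart D ι (FB := fun x => FB g k x e) (hFB k g hg b e).1 (hFB k g hg b e).2) 𝒞.hdrv_on

/-! ## §2 AT THE RECORD's W1 CURRENCY: slots `S`, formats `S.F`, run A read at the transported field (`(assembly S).rawAt`), run B's `S.rawB` -/

variable {IOp Hst : Type*} [NormedAddCommGroup Hst] [NormedSpace ℂ Hst]

/-- [folklore] **ROW E-avg — THE ROAD-D W1 CHAIN AT THE INSTANCE ON THE FINE-FIELD ROAD (whole carrier, slots `S` of record type).**  For
`S : B13StepOfRecord.Slots D.toTwoRuns E IOp Hst`: the W1 face OF RECORD `hwer : WeightedEntrywiseRate S.F (assembly S).rawAt S.rawB W δ (k ↦ θ^k)`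
(run A read at the TRANSPORTED field — RULE R4; EXACTLY the conclusion shape of the owner's `B13ReadingsRecord*` faces and of the substrate's W-21b ∕
W-21c at their `S`, there `θ := √(max θ₀ L⁻¹)`), the runs' complex kernels `FA`∕`FB` with their restriction identities `hAr`∕`hBr` (DISPLAYED), (L1)
own-chart (DISPLAYED), and W-22′'s chart over the whole carrier ⟹ W1 of Road D over the recursion chart `𝒰` FOR THE FORMATS OF RECORD `S.F` at the
owner's degraded pair, + `RawBounded` ×2.  (Window form: §1 `_on` at `rawAr := fun g b k => (assembly S).rawAt g b.1 k`, one line.) -/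
theorem weightedEntrywiseRate_chart_of_record (S : Slots D.toTwoRuns E IOp Hst) {emb : 𝒰 → TwoRunChart D o}
    {ϱ : ℕ → D.carriers.BgB → ℝ} {r : ℝ} (𝒞 : FineFieldChart D ι (Set.univ : Set D.carriers.BgB) 𝒰 emb ϱ r)
    {FA : (ℕ → ℝ) → ℕ → TowerData (D.F.P D.K) o → E → ℂ} {FB : (ℕ → ℝ) → ℕ → TowerData (D.F.P (D.K + 1)) o → E → ℂ}
    {W : Set (ℕ → ℝ)} {δ θ B : ℝ} (hδ : 0 ≤ δ) (hδB : δ ≤ 2 * B) (hθ : 0 ≤ θ) (hθ1 : θ ≤ 1) (hr : r < 1)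
    (hAr : ∀ g ∈ W, ∀ (b : D.carriers.BgB) (k : ℕ), (assembly S).rawAt g b k = FA g k (sectionOfRecord D ι b).1)
    (hBr : ∀ g ∈ W, ∀ (b : D.carriers.BgB) (k : ℕ), S.rawB g b k = FB g k (towerB D ι b))
    (hwer : WeightedEntrywiseRate S.F (assembly S).rawAt S.rawB W δ fun k => θ ^ k)
    (hFA : ∀ k, ∀ g ∈ W, ∀ (b : D.carriers.BgB) (e : E),
      DifferentiableOn ℂ (fun cA => FA g k (expChartT _ (sectionOfRecord D ι b).1 cA) e) (ball 0 (ϱ k b)) ∧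
      ∀ cA ∈ ball (0 : TowerData (D.F.P D.K) o) (ϱ k b), ‖FA g k (expChartT _ (sectionOfRecord D ι b).1 cA) e‖ ≤ B * (S.F k).wt e)
    (hFB : ∀ k, ∀ g ∈ W, ∀ (b : D.carriers.BgB) (e : E),
      DifferentiableOn ℂ (fun c => FB g k (expChartT _ (towerB D ι b) c) e) (ball 0 (ϱ k b)) ∧
      ∀ c ∈ ball (0 : TowerData (D.F.P (D.K + 1)) o) (ϱ k b), ‖FB g k (expChartT _ (towerB D ι b) c) e‖ ≤ B * (S.F k).wt e) :
    WeightedEntrywiseRate S.F (fun g u k => FA g k (emb u).1) (fun g u k => FB g k (emb u).2) W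
      (δ ^ (1 - (2 / π * Real.arctan (2 * r / (1 - r ^ 2)))) * (2 * B) ^ (2 / π * Real.arctan (2 * r / (1 - r ^ 2)))) (fun k => (θ ^ (1 - (2 / π * Real.arctan (2 * r / (1 - r ^ 2))))) ^ k) ∧
      RawBounded S.F (fun g u k => FA g k (emb u).1) W ∧ RawBounded S.F (fun g u k => FB g k (emb u).2) W :=
  weightedEntrywiseRate_chart_of_fineFieldChart D ι 𝒞 S.F hδ hδB hθ hθ1 hr hAr hBr hwer hFA hFB

/-! ## §3 … and the channel road's END on top: `T4OutputRate.NE5` on the carriers of record from the instance letters -/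

variable {F : HistFrame D.carriers} {ιx : Type}
variable {T : ℕ → (ℕ → ℝ) → (𝒰 × Fin 2 → D.carriers.Dom → ℝ) → ιx → ℝ} {out : 𝒰 × Fin 2 → F.Idx → ιx}

/-- [folklore] **ROW E-avg ON THE CHANNEL ROAD — `T4OutputRate.NE5` ON THE CARRIERS OF RECORD FROM THE INSTANCE LETTERS.**  Part 8's END
`InsertionChannelFamily.ne5_of_pointwiseSlots_reIm_insAtC_of_weightedEntrywiseRate` fed by §2: per-point slots `P` on Road D's doubled complex chart
`𝒰 × Fin 2` over `D.carriers` whose operator slots read, row-blind, the ASSEMBLED chart families of the kernels (`hopA`∕`hopB`), + §2's letters, the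
margin floor `0 < r₀ ≤ P.rOp k`, and part 5's channel-road letters (W2 `henv`, W4 `hinsRate` at the degraded rate `θ₁`, the complex channel insertion
`hins` + row NE9's displayed letters, representation ∕ admissibility ∕ decay identities, smallness at `θ₁`) ⟹ LITERALLY `T4OutputRate.NE5 EA EB W κ
θ₁ C₅` on `D.carriers`, `θ₁ = θ^{1−λ(r)}`. -/
theorem ne5_channel_of_record_fineFieldChart [Nonempty 𝒰] (S : Slots D.toTwoRuns E IOp Hst) {emb : 𝒰 → TwoRunChart D o}
    {ϱ : ℕ → D.carriers.BgB → ℝ} {r : ℝ} (𝒞 : FineFieldChart D ι (Set.univ : Set D.carriers.BgB) 𝒰 emb ϱ r)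
    (P : PointwiseSlots D.carriers (𝒰 × Fin 2) (OpDatum E) (Hist F))
    {FA : (ℕ → ℝ) → ℕ → TowerData (D.F.P D.K) o → E → ℂ} {FB : (ℕ → ℝ) → ℕ → TowerData (D.F.P (D.K + 1)) o → E → ℂ}
    {ℰA ℰB : (ℕ → ℝ) → 𝒰 → D.carriers.Dom → ℂ} {EA : Functional D.carriers D.carriers.BgA}
    {EB : Functional D.carriers D.carriers.BgB} {W : Set (ℕ → ℝ)} {κ G' E₀ δ B r₀ δ' θ c ω : ℝ} {wt : ℕ → ιx → ℝ} {τ : ℕ → ℕ → ℝ}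
    (hbdA : ∀ g ∈ W, ∀ k, BddAbove (Set.range fun w => ‖P.insA g k (tableA (reImTab (C := D.carriers) ℰA) g PUnit.unit) w‖))
    (hbdB : ∀ g ∈ W, ∀ k, BddAbove (Set.range fun w => ‖P.insB g k (tableB (reImTab (C := D.carriers) ℰB) g PUnit.unit) w‖))
    (hrA : ∀ g ∈ W, ∀ (X : D.carriers.Dom) (u : 𝒰) (i : Fin 2), ℰA g u X =
      P.Out (D.carriers.scale X) (P.opA g (D.carriers.scale X) (u, i))
        (P.insA g (D.carriers.scale X) (tableA (reImTab (C := D.carriers) ℰA) g PUnit.unit) (u, i)) X)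
    (hrB : ∀ g ∈ W, ∀ (X : D.carriers.Dom) (u : 𝒰) (i : Fin 2), ℰB g u X =
      P.Out (D.carriers.scale X) (P.opB g (D.carriers.scale X) (u, i))
        (P.insB g (D.carriers.scale X) (tableB (reImTab (C := D.carriers) ℰB) g PUnit.unit) (u, i)) X)
    (hbase : ∀ k, ∀ g ∈ W, ∀ w,
      (P.opB g k w, P.insB g k (tableB (reImTab (C := D.carriers) ℰB) g PUnit.unit) w) ∈ P.Base k g w)
    (henv : ∀ k, ∀ g ∈ W, ∀ w, ∀ q ∈ P.Base k g w, ∀ X : D.carriers.Dom, D.carriers.scale X = k →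
      DifferentiableOn ℂ (fun z : OpDatum E × Hist F => P.Out k z.1 z.2 X) (closedBall q.1 (P.rOp k) ×ˢ closedBall q.2 (P.rHist k)) ∧
        ∀ z ∈ closedBall q.1 (P.rOp k) ×ˢ closedBall q.2 (P.rHist k), ‖P.Out k z.1 z.2 X‖ ≤ G' * Real.exp (-(κ * D.carriers.d X)))
    (hdA : ∀ g ∈ W, ∀ (u : 𝒰) (X : D.carriers.Dom), ‖ℰA g u X‖ ≤ G' * Real.exp (-(κ * D.carriers.d X)))
    (hdB : ∀ g ∈ W, ∀ (u : 𝒰) (X : D.carriers.Dom), ‖ℰB g u X‖ ≤ E₀ * Real.exp (-(κ * D.carriers.d X))) (hE₀ : E₀ ≤ G')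
    -- the operator slots read the assembled chart families of the kernels, row-blind:
    (hopA : ∀ g ∈ W, ∀ (k : ℕ) (w : 𝒰 × Fin 2), P.opA g k w = opOf S.F (fun g u k => FA g k (emb u).1) g w.1 k)
    (hopB : ∀ g ∈ W, ∀ (k : ℕ) (w : 𝒰 × Fin 2), P.opB g k w = opOf S.F (fun g u k => FB g k (emb u).2) g w.1 k)
    -- the W1 face of record, the kernel readings at the section of record, (L1) in the runs' own chart letters:
    (hAr : ∀ g ∈ W, ∀ (b : D.carriers.BgB) (k : ℕ), (assembly S).rawAt g b k = FA g k (sectionOfRecord D ι b).1)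
    (hBr : ∀ g ∈ W, ∀ (b : D.carriers.BgB) (k : ℕ), S.rawB g b k = FB g k (towerB D ι b))
    (hwer : WeightedEntrywiseRate S.F (assembly S).rawAt S.rawB W δ fun k => θ ^ k)
    (hFA : ∀ k, ∀ g ∈ W, ∀ (b : D.carriers.BgB) (e : E),
      DifferentiableOn ℂ (fun cA => FA g k (expChartT _ (sectionOfRecord D ι b).1 cA) e) (ball 0 (ϱ k b)) ∧
      ∀ cA ∈ ball (0 : TowerData (D.F.P D.K) o) (ϱ k b), ‖FA g k (expChartT _ (sectionOfRecord D ι b).1 cA) e‖ ≤ B * (S.F k).wt e)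
    (hFB : ∀ k, ∀ g ∈ W, ∀ (b : D.carriers.BgB) (e : E),
      DifferentiableOn ℂ (fun c => FB g k (expChartT _ (towerB D ι b) c) e) (ball 0 (ϱ k b)) ∧
      ∀ c ∈ ball (0 : TowerData (D.F.P (D.K + 1)) o) (ϱ k b), ‖FB g k (expChartT _ (towerB D ι b) c) e‖ ≤ B * (S.F k).wt e)
    (hδ0 : 0 ≤ δ) (hδB : δ ≤ 2 * B) (hθ0 : 0 ≤ θ) (hθ1 : θ ≤ 1) (hr : r < 1)
    (hfl : ∀ k, r₀ ≤ P.rOp k) (hr₀ : 0 < r₀)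
    -- the channel-road letters of part 5, W4 at the DEGRADED rate `θ₁`:
    (hinsRate : ∀ k, ∀ g ∈ W, ∀ (t : D.carriers.Dom × (𝒰 × Fin 2) → ℝ), (∀ Y w, |t (Y, w)| ≤ E₀ * Real.exp (-(κ * D.carriers.d Y))) →
      ∀ w, ‖P.insA g k t w - P.insB g k t w‖ ≤ δ' * (θ ^ (1 - (2 / π * Real.arctan (2 * r / (1 - r ^ 2))))) ^ k * P.rHist k)
    (hins : ∀ k, ∀ g ∈ W, ∀ (t : D.carriers.Dom × (𝒰 × Fin 2) → ℝ) (w : 𝒰 × Fin 2), P.insA g k t w = insAtOfChannelC T out g k t w)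
    (hadd : ChannelAdditive (Set.univ : Set (𝒰 × Fin 2 → D.carriers.Dom → ℝ)) T)
    (hsum : ChannelStepSum (Set.univ : Set (𝒰 × Fin 2 → D.carriers.Dom → ℝ)) T)
    (hsize : ChannelSizeAtStepNN (Set.univ : Set (𝒰 × Fin 2 → D.carriers.Dom → ℝ)) T κ wt τ) (hwt0 : ∀ k w i, 0 ≤ wt k (out w i))
    (hwt : ∀ k w i, wt k (out w i) ≤ P.rHist (k + 1) * F.wt i) (hτ : ∀ k j, j ≤ k → τ k j ≤ c * ω ^ (k - j))
    (hG : 0 ≤ G') (hδ' : 0 ≤ δ') (hc : 0 ≤ c) (hω : 0 < ω) (hsmall : (1 + 4 * G' * (Real.sqrt 2 * c / ω)) * ω < θ ^ (1 - (2 / π * Real.arctan (2 * r / (1 - r ^ 2)))))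
    (ι' : D.carriers.BgB → 𝒰) (hιA : ∀ g ∈ W, ∀ (U : D.carriers.BgB) (X : D.carriers.Dom), EA g (D.carriers.transport U) X = (ℰA g (ι' U) X).re)
    (hιB : ∀ g ∈ W, ∀ (U : D.carriers.BgB) (X : D.carriers.Dom), EB g U X = (ℰB g (ι' U) X).re) :
    NE5 EA EB W κ (θ ^ (1 - (2 / π * Real.arctan (2 * r / (1 - r ^ 2)))))
      (4 * G' * (δ ^ (1 - (2 / π * Real.arctan (2 * r / (1 - r ^ 2)))) * (2 * B) ^ (2 / π * Real.arctan (2 * r / (1 - r ^ 2))) / r₀ + δ') * (θ ^ (1 - (2 / π * Real.arctan (2 * r / (1 - r ^ 2)))) - ω) /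
        (θ ^ (1 - (2 / π * Real.arctan (2 * r / (1 - r ^ 2)))) - (1 + 4 * G' * (Real.sqrt 2 * c / ω)) * ω)) := by
  obtain ⟨hW, hRA, hRB⟩ := weightedEntrywiseRate_chart_of_record D ι S 𝒞 hδ0 hδB hθ0 hθ1 hr hAr hBr hwer hFA hFB
  exact ne5_of_pointwiseSlots_reIm_insAtC_of_weightedEntrywiseRate P S.F hbdA hbdB hrA hrB hbase henv hdA hdB hE₀ hopA hopB hRA hRB hW
    (degradedAmp_nonneg hδ0 hδB) hfl hr₀ hinsRate hins hadd hsum hsize hwt0 hwt hτ hG hδ' hc hω hsmall ι' hιA hιB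

/-! ## §4 THE INSTANCE OF RECORD: W1 := the substrate's W-21c `SubstrateO1ReadingsShiftRate` BY NAME at the cov-shifted slots `slotsOfRecordShift` -/

section Instance

open Summit.QuantumFields.BalabanUV.T4Continuum
open Summit.QuantumFields.BalabanUV.T4Continuum.B13OpDatum
open Summit.QuantumFields.BalabanUV.T4Continuum.B13OpDatumJunctions (WeightedEntrywiseRate)
open Summit.QuantumFields.BalabanUV.T4Continuum.B13ReadingsDecay (ReadsTowerCovA ReadsTowerCovB CovWeightDominatesDist)
open Summit.QuantumFields.BalabanUV.T4Continuum.B13ReadingsImage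
open Summit.QuantumFields.BalabanUV.T4Continuum.B13ReadingsLocal (PotQLipschitzReading PotRLipschitzReading)
open Summit.QuantumFields.BalabanUV.T4Continuum.B13ReadingsAssembly (CpertRec)
open Summit.QuantumFields.BalabanUV.T4Continuum.B13ReadingsLevelWindow (ReadsTowerCovAOn ReadsTowerCovBOn)
open Summit.QuantumFields.BalabanUV.T4Continuum.DecayRateInterpolation (EntryDecay)
open Summit.QuantumFields.BalabanUV.T4Continuum.B13StepTermLabels (InnerLabel)
open Summit.QuantumFields.BalabanUV.T4Continuum.B13InnerData (Bnd)
open Summit.QuantumFields.BalabanUV.T4Continuum.B13StepOfRecord (Slots assembly)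
open Summit.QuantumFields.BalabanUV.T4Continuum.B13HistMeasurable (MeasPotFrame B13HistM)
open Summit.QuantumFields.BalabanUV.T4Continuum.CovariantBlockAveraging (ContourSystem)
open Summit.QuantumFields.BalabanUV.T4Continuum.SubstrateBackgroundTransporters (unitMod)
open Summit.QuantumFields.BalabanUV.T4Continuum.SubstrateTwoRunsDriven (DrivenRuns)
open Summit.QuantumFields.BalabanUV.T4Continuum.SubstrateRawSpecies
open Summit.QuantumFields.BalabanUV.T4Continuum.SubstrateSlotsOfRecord
open Summit.QuantumFields.BalabanUV.T4Continuum.SubstrateSlotsOfRecordShift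
open Literature.MathematicalPhysics.QuantumFieldTheory.Balaban1983to89
open Literature.MathematicalPhysics.QuantumFieldTheory.Balaban1983to89.B5Prop11Plancherel (Cst Cst_nonneg Tor fine)
open Literature.MathematicalPhysics.QuantumFieldTheory.Balaban1983to89.B5G183RateUnitTower (lev lev_neZero)
open Literature.MathematicalPhysics.QuantumFieldTheory.Balaban1983to89.T4EtaRateMin (Readings LocalRate NE3Shape)
open Summit.QuantumFields.BalabanUV.T4Continuum.BalabanAveragedTowerUnit (idx Qlev)
open Summit.QuantumFields.BalabanUV.T4Continuum.NE2FromNE3 (bgReadings)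
open Summit.QuantumFields.BalabanUV.T4Continuum.NE2ColourPerturbedLayer (pertCovC)
open Summit.QuantumFields.BalabanUV.T4Continuum.RegularBackgroundTower (RegularTransporters regClass betaNE3)
open Summit.QuantumFields.BalabanUV.T4Continuum.GaugeTermScalarData (QuT Q1)
open Summit.QuantumFields.BalabanUV.T4Continuum.RegularSiteTransporters (siteT)
open Summit.QuantumFields.BalabanUV.T4Continuum.NE2BalabanRoot (balabanPert)
open Summit.QuantumFields.BalabanUV.T4Continuum.NE2BalabanGauge (gaugeSlot liftR)
open Summit.QuantumFields.BalabanUV.T4Continuum.NE2BalabanThreshold (etaStar smallness_of_le)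
open Summit.QuantumFields.BalabanUV.T4Continuum.SubstrateO1ReadingsShiftRate (weightedEntrywiseRate_slotsOfRecordShift_balaban_rate)

-- the substrate's telescope for `slotsOfRecordShift` (W-21; same letters as p220104 §SlotsRecord), renamed where they would shadow the owner's
variable {G : Type} [GaugeGroup G] (D : DrivenRuns G)
variable {oc : Type} [Fintype oc] [DecidableEq oc] (ιr : G →* Matrix oc oc ℂ) (cc : ℂ) (ag : ℝ) (sg : ℕ → ℂ)
variable {T ι' Sy Ω 𝒴 : Type} (Pm : MeasPotFrame D.carriers) {IOp : Type*}
  (𝒵 : D.carriers.Dom → InnerLabel D.carriers.Dom (Bnd D.toTwoRuns) → Type) [∀ Z j, Fintype (𝒵 Z j)] (domZ : ∀ Z j, 𝒵 Z j → D.carriers.Dom)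
  (Jc : D.carriers.Dom → InnerLabel D.carriers.Dom (Bnd D.toTwoRuns) → Type) [∀ Z j, Fintype (Jc Z j)]
  (Vv : D.carriers.Dom → InnerLabel D.carriers.Dom (Bnd D.toTwoRuns) → Type) [∀ Z j, NormedAddCommGroup (Vv Z j)]
  [∀ Z j, InnerProductSpace ℝ (Vv Z j)] [∀ Z j, MeasurableSpace (Vv Z j)] [∀ Z j, BorelSpace (Vv Z j)] [∀ Z j, FiniteDimensional ℝ (Vv Z j)]
  (mI : D.carriers.Dom → InnerLabel D.carriers.Dom (Bnd D.toTwoRuns) → Type) [∀ Z j, Fintype (mI Z j)] [∀ Z j, DecidableEq (mI Z j)]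
  (Lsl : SlotLetters D (o := oc) (T := T) (ι' := ι') (S := Sy) (Ω := Ω) (𝒴 := 𝒴) Pm (IOp := IOp) 𝒵 domZ Jc Vv mI)
-- node NE3 ∕ the owner's letters
variable {d : ℕ} (L : ℕ) [NeZero L] (M : Fin d → ℕ) [hM : ∀ μ, NeZero (M μ)] (a : ℝ) (ha : 0 < a)
variable {o : Type*} [Fintype o] [DecidableEq o] {α β C a' η : ℝ} {m : Type*} [Fintype m] [DecidableEq m] {BgD ιp Xp : Type*}

/-- [folklore] **ROW E-avg AT THE SUBSTRATE's COV-SHIFTED SLOTS OF RECORD, W1 := W-21c BY NAME.**  §2 at `S := slotsOfRecordShift D ιr …` (W-21;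
entry type `SpeciesRec D oc T ι' Ω 𝒴`, formats `(Lsl.W k).format`) with `hwer` DISCHARGED by the substrate's W-21c
`SubstrateO1ReadingsShiftRate.weightedEntrywiseRate_slotsOfRecordShift_balaban_rate` (the owner's rate-road record face g38-c AT the shifted slots: row
NE2's per-background two-level-consistency binder `hloc` on the averaging tower, the (3.35)-class ∕ threshold letters, the O1 reading ∕ decay ∕
Lipschitz ∕ domination letters — ALL DISPLAYED exactly as W-21c displays them, asserted by nobody), chart representation := the record's `ιr`, real
rate `θ_W := √(max θ L⁻¹)`; new displayed letters of THIS road: the runs' complex kernels `FA`∕`FB` with their restriction identities at the two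
factors of the section of record, (L1) own-chart with format bound `B`, `hcB : c_W ≤ 2B`, and W-22′'s chart `𝒞` over the whole run-B carrier.
Conclusion: W1 of Road D over the recursion chart for the formats of record at `(c_W^{1−λ}(2B)^{λ}, (θ_W^{1−λ})^k)`, + `RawBounded` ×2. -/
theorem weightedEntrywiseRate_chart_of_slotsOfRecordShift_rate
    {dom : Set BgD} (hL : 2 ≤ L) (hd : 1 ≤ d)
    {RgV : BgD → ((k : ℕ) → Fin d → (Tor (fine (lev L k) M) → Matrix o o ℂ))}
    (hreg : ∀ V ∈ dom, RegularTransporters L M (liftR L M (RgV V)) α β) (hα : 0 ≤ α) (hβ : 0 ≤ β) (hC : 0 ≤ C) {θ : ℝ}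
    (hθ0 : 0 ≤ θ) (hθ1 : θ < 1) (hloc : ∀ V ∈ dom, LocalRate (bgReadings L M (regClass L M (liftR L M (RgV V)))) C θ)
    {Rp : Readings ιp Xp} (hRp : LocalRate Rp C θ)
    (ha' : 0 < a') (hαη : α ≤ η) (hβη : β ≤ η) (hη : η ≤ etaStar o d a a')
    {tow : ℕ → (ℕ → ℝ) → D.toTwoRuns.carriers.BgB → ↥dom} {W : Set (ℕ → ℝ)}
    {σ : T → ((Tor (unitMod (D.F.P D.K)) × Fin (D.F.P D.K).d) × oc) → idx L M 0 × o} {dist₁ : idx L M 0 × o → idx L M 0 × o → ℝ} {B₁ δ₁ : ℝ}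
    (hdec : ∀ V ∈ dom, ∀ k, EntryDecay dist₁
      (pertCovC L M a ha (balabanPert L M a (liftR L M (RgV V)) (gaugeSlot L M (RgV V) (QuT L M o (siteT L M (RgV V))) (Q1 L M o) a'))
        1 k) B₁ δ₁)
    (hcovA : ReadsTowerCovAOn {k : ℕ | k ≤ D.K}
      (fun V : ↥dom => pertCovC L M a ha
        (balabanPert L M a (liftR L M (RgV V)) (gaugeSlot L M (RgV V) (QuT L M o (siteT L M (RgV V))) (Q1 L M o) a')) 1)
      σ tow (fun g U k => (rawAOfRecord ιr D cc ag sg Lsl.ΓA Lsl.dkA Lsl.gcA Lsl.pQA Lsl.pRA) g (D.toTwoRuns.carriers.transport U) k) W)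
    (hcovB : ReadsTowerCovBOn {k : ℕ | k ≤ D.K}
      (fun V : ↥dom => pertCovC L M a ha
        (balabanPert L M a (liftR L M (RgV V)) (gaugeSlot L M (RgV V) (QuT L M o (siteT L M (RgV V))) (Q1 L M o) a')) 1)
      σ tow (rawBOfRecordShift D ιr cc ag sg Lsl.ΓB Lsl.dkB Lsl.gcB Lsl.pQB Lsl.pRB) W)
    (hdom₁ : CovWeightDominatesDist (slotsOfRecordShift D ιr cc ag sg Pm 𝒵 domZ Jc Vv mI Lsl).F dist₁ σ (δ₁ / 2))
    {S₂ : Set (Matrix (idx L M 0 × o) (idx L M 0 × o) ℂ)} {Φ : T → Matrix (idx L M 0 × o) (idx L M 0 × o) ℂ → Matrix m m ℂ}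
    {Λ₂ : ℝ} (hΦ : ∀ t, OpLipschitzOn S₂ (Φ t) Λ₂) (hΛ₂ : 0 ≤ Λ₂)
    (hS₂ : ∀ V ∈ dom, ∀ k, pertCovC L M a ha
      (balabanPert L M a (liftR L M (RgV V)) (gaugeSlot L M (RgV V) (QuT L M o (siteT L M (RgV V))) (Q1 L M o) a')) 1 k ∈ S₂)
    {dist₂ : m → m → ℝ} {B₂ δ₂ : ℝ}
    (hdecΦ : ∀ V ∈ dom, ∀ t k, EntryDecay dist₂ (Φ t (pertCovC L M a ha
      (balabanPert L M a (liftR L M (RgV V)) (gaugeSlot L M (RgV V) (QuT L M o (siteT L M (RgV V))) (Q1 L M o) a')) 1 k)) B₂ δ₂)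
    {σX : T → ι' → m}
    (hΔA : ReadsTowerDeltaA (fun (V : ↥dom) t k => Φ t (pertCovC L M a ha
      (balabanPert L M a (liftR L M (RgV V)) (gaugeSlot L M (RgV V) (QuT L M o (siteT L M (RgV V))) (Q1 L M o) a')) 1 k))
      σX tow (fun g U k => (rawAOfRecord ιr D cc ag sg Lsl.ΓA Lsl.dkA Lsl.gcA Lsl.pQA Lsl.pRA) g (D.toTwoRuns.carriers.transport U) k) W)
    (hΔB : ReadsTowerDeltaB (fun (V : ↥dom) t k => Φ t (pertCovC L M a ha
      (balabanPert L M a (liftR L M (RgV V)) (gaugeSlot L M (RgV V) (QuT L M o (siteT L M (RgV V))) (Q1 L M o) a')) 1 k))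
      σX tow (rawBOfRecordShift D ιr cc ag sg Lsl.ΓB Lsl.dkB Lsl.gcB Lsl.pQB Lsl.pRB) W)
    (hdom₂ : DeltaWeightDominatesDist (slotsOfRecordShift D ιr cc ag sg Pm 𝒵 domZ Jc Vv mI Lsl).F dist₂ σX (δ₂ / 2))
    {S₃ : Set (Matrix (idx L M 0 × o) (idx L M 0 × o) ℂ)} {Ψ : T → Matrix (idx L M 0 × o) (idx L M 0 × o) ℂ → Matrix m m ℂ}
    {Λ₃ : ℝ} (hΨ : ∀ t, OpLipschitzOn S₃ (Ψ t) Λ₃) (hΛ₃ : 0 ≤ Λ₃)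
    (hS₃ : ∀ V ∈ dom, ∀ k, pertCovC L M a ha
      (balabanPert L M a (liftR L M (RgV V)) (gaugeSlot L M (RgV V) (QuT L M o (siteT L M (RgV V))) (Q1 L M o) a')) 1 k ∈ S₃)
    {dist₃ : m → m → ℝ} {B₃ δ₃ : ℝ}
    (hdecΨ : ∀ V ∈ dom, ∀ t k, EntryDecay dist₃ (Ψ t (pertCovC L M a ha
      (balabanPert L M a (liftR L M (RgV V)) (gaugeSlot L M (RgV V) (QuT L M o (siteT L M (RgV V))) (Q1 L M o) a')) 1 k)) B₃ δ₃)
    {σB : T → ((Tor (unitMod (D.F.P D.K)) × Fin (D.F.P D.K).d) × oc) → m}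
    (hΓA : ReadsTowerGammaA (fun (V : ↥dom) t k => Ψ t (pertCovC L M a ha
      (balabanPert L M a (liftR L M (RgV V)) (gaugeSlot L M (RgV V) (QuT L M o (siteT L M (RgV V))) (Q1 L M o) a')) 1 k))
      σB σX tow (fun g U k => (rawAOfRecord ιr D cc ag sg Lsl.ΓA Lsl.dkA Lsl.gcA Lsl.pQA Lsl.pRA) g (D.toTwoRuns.carriers.transport U) k) W)
    (hΓB : ReadsTowerGammaB (fun (V : ↥dom) t k => Ψ t (pertCovC L M a ha
      (balabanPert L M a (liftR L M (RgV V)) (gaugeSlot L M (RgV V) (QuT L M o (siteT L M (RgV V))) (Q1 L M o) a')) 1 k))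
      σB σX tow (rawBOfRecordShift D ιr cc ag sg Lsl.ΓB Lsl.dkB Lsl.gcB Lsl.pQB Lsl.pRB) W)
    (hdom₃ : GammaWeightDominatesDist (slotsOfRecordShift D ιr cc ag sg Pm 𝒵 domZ Jc Vv mI Lsl).F dist₃ σB σX (δ₃ / 2))
    {Λ₄ Λ₅ : ℝ} (hΛ₄ : 0 ≤ Λ₄) (hΛ₅ : 0 ≤ Λ₅)
    (hQ : PotQLipschitzReading Rp (slotsOfRecordShift D ιr cc ag sg Pm 𝒵 domZ Jc Vv mI Lsl).F
      (fun g U k => (rawAOfRecord ιr D cc ag sg Lsl.ΓA Lsl.dkA Lsl.gcA Lsl.pQA Lsl.pRA) g (D.toTwoRuns.carriers.transport U) k) (rawBOfRecordShift D ιr cc ag sg Lsl.ΓB Lsl.dkB Lsl.gcB Lsl.pQB Lsl.pRB) W Λ₄)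
    (hR : PotRLipschitzReading Rp (slotsOfRecordShift D ιr cc ag sg Pm 𝒵 domZ Jc Vv mI Lsl).F
      (fun g U k => (rawAOfRecord ιr D cc ag sg Lsl.ΓA Lsl.dkA Lsl.gcA Lsl.pQA Lsl.pRA) g (D.toTwoRuns.carriers.transport U) k) (rawBOfRecordShift D ιr cc ag sg Lsl.ΓB Lsl.dkB Lsl.gcB Lsl.pQB Lsl.pRB) W Λ₅)
    -- ↓↓ the letters of THIS road: W-22′'s chart at `ιr`, the runs' complex kernels + restriction identities, (L1) own-chart, `c_W ≤ 2B` ↓↓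
    {𝒰 : Type} {emb : 𝒰 → TwoRunChart D oc} {ϱ : ℕ → D.carriers.BgB → ℝ} {r : ℝ}
    (𝒞 : FineFieldChart D ιr (Set.univ : Set D.carriers.BgB) 𝒰 emb ϱ r) (hr : r < 1)
    {FA : (ℕ → ℝ) → ℕ → TowerData (D.F.P D.K) oc → SpeciesRec D oc T ι' Ω 𝒴 → ℂ}
    {FB : (ℕ → ℝ) → ℕ → TowerData (D.F.P (D.K + 1)) oc → SpeciesRec D oc T ι' Ω 𝒴 → ℂ} {B : ℝ}
    (hAr : ∀ g ∈ W, ∀ (b : D.carriers.BgB) (k : ℕ), (assembly (slotsOfRecordShift D ιr cc ag sg Pm 𝒵 domZ Jc Vv mI Lsl)).rawAt g b k = FA g k (sectionOfRecord D ιr b).1)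
    (hBr : ∀ g ∈ W, ∀ (b : D.carriers.BgB) (k : ℕ), (slotsOfRecordShift D ιr cc ag sg Pm 𝒵 domZ Jc Vv mI Lsl).rawB g b k = FB g k (towerB D ιr b))
    (hFA : ∀ k, ∀ g ∈ W, ∀ (b : D.carriers.BgB) (e : SpeciesRec D oc T ι' Ω 𝒴),
      DifferentiableOn ℂ (fun cA => FA g k (expChartT _ (sectionOfRecord D ιr b).1 cA) e) (ball 0 (ϱ k b)) ∧
      ∀ cA ∈ ball (0 : TowerData (D.F.P D.K) oc) (ϱ k b),
        ‖FA g k (expChartT _ (sectionOfRecord D ιr b).1 cA) e‖ ≤ B * ((slotsOfRecordShift D ιr cc ag sg Pm 𝒵 domZ Jc Vv mI Lsl).F k).wt e)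
    (hFB : ∀ k, ∀ g ∈ W, ∀ (b : D.carriers.BgB) (e : SpeciesRec D oc T ι' Ω 𝒴),
      DifferentiableOn ℂ (fun c => FB g k (expChartT _ (towerB D ιr b) c) e) (ball 0 (ϱ k b)) ∧
      ∀ c ∈ ball (0 : TowerData (D.F.P (D.K + 1)) oc) (ϱ k b),
        ‖FB g k (expChartT _ (towerB D ιr b) c) e‖ ≤ B * ((slotsOfRecordShift D ιr cc ag sg Pm 𝒵 domZ Jc Vv mI Lsl).F k).wt e)
    (hcB :
      (Real.sqrt (2 * B₁ * (2 * CpertRec o d L a α β C a' / (1 - max θ ((L : ℝ)⁻¹)))) +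
          Real.sqrt (2 * B₂ * (Λ₂ * CpertRec o d L a α β C a')) +
          Real.sqrt (2 * B₃ * (Λ₃ * CpertRec o d L a α β C a')) +
          Λ₄ * C + Λ₅ * C) ≤ 2 * B) :
    WeightedEntrywiseRate (slotsOfRecordShift D ιr cc ag sg Pm 𝒵 domZ Jc Vv mI Lsl).F (fun g u k => FA g k (emb u).1) (fun g u k => FB g k (emb u).2) W
      (
      (Real.sqrt (2 * B₁ * (2 * CpertRec o d L a α β C a' / (1 - max θ ((L : ℝ)⁻¹)))) +
          Real.sqrt (2 * B₂ * (Λ₂ * CpertRec o d L a α β C a')) +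
          Real.sqrt (2 * B₃ * (Λ₃ * CpertRec o d L a α β C a')) +
          Λ₄ * C + Λ₅ * C) ^ (1 - (2 / π * Real.arctan (2 * r / (1 - r ^ 2)))) * (2 * B) ^ (2 / π * Real.arctan (2 * r / (1 - r ^ 2))))
      (fun k => (Real.sqrt (max θ ((L : ℝ)⁻¹)) ^ (1 - (2 / π * Real.arctan (2 * r / (1 - r ^ 2))))) ^ k) ∧
      RawBounded (slotsOfRecordShift D ιr cc ag sg Pm 𝒵 domZ Jc Vv mI Lsl).F (fun g u k => FA g k (emb u).1) W ∧
      RawBounded (slotsOfRecordShift D ιr cc ag sg Pm 𝒵 domZ Jc Vv mI Lsl).F (fun g u k => FB g k (emb u).2) W := by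
  have hL1 : (1 : ℝ) ≤ L := by exact_mod_cast (le_trans one_le_two hL : 1 ≤ L)
  have hθW0 : 0 ≤ Real.sqrt (max θ ((L : ℝ)⁻¹)) := Real.sqrt_nonneg _
  have hθW1 : Real.sqrt (max θ ((L : ℝ)⁻¹)) ≤ 1 := Real.sqrt_le_one.mpr (max_le hθ1.le (inv_le_one_of_one_le₀ hL1))
  have hcW :
      0 ≤
      (Real.sqrt (2 * B₁ * (2 * CpertRec o d L a α β C a' / (1 - max θ ((L : ℝ)⁻¹)))) +
          Real.sqrt (2 * B₂ * (Λ₂ * CpertRec o d L a α β C a')) +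
          Real.sqrt (2 * B₃ * (Λ₃ * CpertRec o d L a α β C a')) +
          Λ₄ * C + Λ₅ * C) := by positivity
  exact weightedEntrywiseRate_chart_of_record D ιr (slotsOfRecordShift D ιr cc ag sg Pm 𝒵 domZ Jc Vv mI Lsl) 𝒞 hcW hcB hθW0 hθW1 hr hAr hBr
    (weightedEntrywiseRate_slotsOfRecordShift_balaban_rate D ιr cc ag sg Pm 𝒵 domZ Jc Vv mI Lsl L M a ha hL hd hreg hα hβ hC hθ0 hθ1 hloc hRp
      ha' hαη hβη hη hdec hcovA hcovB hdom₁ hΦ hΛ₂ hS₂ hdecΦ hΔA hΔB hdom₂ hΨ hΛ₃ hS₃ hdecΨ hΓA hΓB hdom₃ hΛ₄ hΛ₅ hQ hR)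
    hFA hFB

end Instance
end Summit.QuantumFields.BalabanUV.T4Continuum.B13EntrywiseRateFineField

end
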